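import Mathlib
import HarnessLib
import HarnessLib.Audit
import Summits.AnomalousDissipation.Statement
import Literature.Analysis.FluidPDE.StokesTorus
import Literature.Analysis.FluidPDE.LongTimeAveragePeriodic
import Literature.Analysis.FluidPDE.TorusClassicalLerayHopfProofs
import Literature.Analysis.FunctionSpaces.TorusFourierCalculus
import Literature.Analysis.FunctionSpaces.TorusCalculusProofs
import Summits.AnomalousDissipation.AnomalousDissipation.Theorems.TaylorCertificatesSteadyStatesLoudBoundedStubGpAdmissible
import Summits.AnomalousDissipation.AnomalousDissipation.Theorems.TaylorCertificatesPhantomFloorLawPairing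
import HarnessLib.Audit.Status.Attr

/-!
Route: VirtualDissipation

DORMANT since 2026-08-26T10:53:59Z (reconciler: no traction for 8.3 d (last activity item-evidence-added at 2026-08-18T03:08:37Z); parked, not closed — `ledger route dormant route-AnomalousDissipation-VirtualDissipation --off` to reacti) — unstaffed, not closed; items shared with open routes are served there. `ledger route dormant <id> --off` reactivates.

# Route VirtualDissipation — Virtual dissipation — a ν-free Lamb-rigidity inequality for f_GP makes
every light steady state loud, and light steady states of f_GP exist

Realises idea card virtual-dissipation-magic-cone (mechanism, graded new-mechanism) with the pinned
Galloway–Proctor force f_GP(x) = sin(2πx₃)e₁ + sin(2πx₁)e₂ + sin(2πx₂)e₃ on the unit torus (inline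
sum of three Stokes modes, exactly the expression of FrustratedForces / TaylorCertificates). VIRTUAL
DISSIPATION: for any smooth divergence-free mean-zero field U let R(U) be the dual-enstrophy norm of
the steady-Euler residual, R(U) = sup over smooth div-free mean-zero w with ‖∇w‖₂ ≤ 1 of ∫⟪(U·∇)U −
f_GP, w⟫; at EVERY steady state of NS_ν(f_GP) the residual functional IS ν(Δu, ·), so R(u) = ν‖∇u‖₂
and R(u)·‖∇u‖₂ = ν‖∇u‖₂² = ε exactly, for every ν. It suffices to show X = X1 ∧ X2: (X1 =
LambRigidGP, ν-FREE and PDE-free) at some energy level E ≥ 2 there are c, δ₀ > 0 such that every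
smooth div-free mean-zero U with ∫|U|² ≤ E and residual bound R ≤ δ₀ pays roughness c ≤ R‖∇U‖₂ —
f_GP cannot be faked by the quadratic Lamb map below the Onsager rate (in particular it has no
smooth mean-zero steady Euler dodger of energy ≤ E); (X2 = LightSteadyStatesGP) along some ν_j → 0
(ν_j ≤ 1) there are mean-zero classical steady states u_j of NS_{ν_j}(f_GP) with ∫|u_j|² ≤ 2. Then
every u_j is LOUD, ν_j‖∇u_j‖₂² ≥ min(c, δ₀²) (residual transfer, proved inside `closes`), and steady
classical states are global Leray–Hopf solutions whose long-time means are their slice values: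
AnomalousDissipation.
Lean: `LambRigidGP ∧ LightSteadyStatesGP` (the two crux decls of this route, written out in full
under Cruxes; both elaborate and `closes : LambRigidGP → LightSteadyStatesGP → AnomalousDissipation`
is proved sorry-free, lean rc 0, gate audit ok, axioms propext/Classical.choice/Quot.sound; rev 1 =
route-repair 2026-08-16, see CONE in the rationale)

## Assembly
Pure logic plus LANDED lemmas, certified (theorem `closes`, rc 0, no sorry, standard axioms): from
LambRigidGP take (E ≥ 2, c, δ₀, rigidity); from LightSteadyStatesGP take (ν_j, u_j, p_j). f_GP is
smooth, divergence-free, mean-zero by the landed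
`…Theorems.SteadyStatesLoudBounded.GpAdmissible.stub_gpAdmissible`. Each slice u_j is smooth and
divergence-free (fields of IsClassicalNSSolutionOn), and the momentum equation with ∂ₜ(const) = 0
gives νΔu_j − (u_j·∇)u_j + f_GP = ∇p_j pointwise, hence the tested steady identity against smooth
div-free mean-zero w (Torus.integral_inner_gradient_eq_zero_of_isDivFree). RESIDUAL TRANSFER (proved
inside `closes` since rev 1; formerly the imported stub_residualTransfer p85255): by linearity the
tested steady identity reads ∫⟪(u_j·∇)u_j − f_GP, w⟫ = ν_j∫⟪w, Δu_j⟫, and the landed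
`…Theorems.PhantomFloor.abs_integral_inner_laplacian_le` (Green's first identity + Cauchy–Schwarz;
Theorems/TaylorCertificatesPhantomFloorLawPairing.lean) bounds this by ν_j‖∇u_j‖₂‖∇w‖₂, so R_j :=
ν_j‖∇u_j‖₂ is an admissible residual bound for u_j; either R_j ≤ δ₀ and rigidity gives c ≤
R_j‖∇u_j‖₂ = ν_j‖∇u_j‖₂², or R_j > δ₀ and ν_j‖∇u_j‖₂² = R_j²/ν_j ≥ R_j² > δ₀² (ν_j ≤ 1): in both
cases ν_j‖∇u_j‖₂² ≥ min(c, δ₀²) > 0. The constant paths t ↦ u_j are global Leray–Hopf solutions from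
u_j (IsClassicalNSSolutionOn.isGlobalLerayHopf, Robinson–Rodrigo–Sadowski Thm 6.5), meanEnergy =
∫|u_j|² ≤ 2 and meanDissipation = ν_j‖∇u_j‖₂² (meanEnergy/meanDissipation_eq_of_periodic with τ = 1,
gradNormSq_eq_toReal_eGradNormSq_holds). Witnesses of Literature.Turb.ZerothLaw: (f_GP, ν, u_j, t ↦
u_j, E = 2, ε = min c δ₀²).

Rationale: WHY THIS LINE. The mechanism (card virtual-dissipation-magic-cone): weigh the steady-Euler residual
of an ARBITRARY smooth field against its roughness; on steady states the product is the dissipation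
exactly, so the steady zeroth law for a pinned force is squeezed from below by a viscosity-free
inverse theorem of approximation for the quadratic Lamb map U ↦ P div(U⊗U) — "a force that cannot be
faked cheaply is dissipated loudly by every light steady state". What is imported:
compensated-compactness / convex-integration bookkeeping as the ADVERSARY calibrating X1 (one-stage
laminates saturate at rate ½ = α/(1−α) at α = 1/3; only single modulated shear waves fake a force to
O(λ⁻³), and they reach exactly the MAGIC CONE 𝓜 = {½P[Re(e⊗ē)∇g]}, which contains the Kolmogorov
force and excludes f_GP by a mode-wise curl test; stationary h-principles in print are L^∞ with no
prescribed body force, arXiv:1401.4301 Thm 1, arXiv:2405.08390 Thm 1.1 (linear source Bv only), or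
Hölder but unforced, arXiv:2501.13632, and the stationary Nash error forbids exactly the vanishing
of the iterates' virtual dissipation: R_q‖∇u_q‖ ≍ λ_q^(1−β−2βb) with admissible b ≤ (1−β)/(2β));
steady Navier–Stokes theory for X2 (Temam1979 Ch. II; arXiv:2402.13346 Thm 4.3–4.7) plus the hub's
continuation numerics of the f_GP steady variety. Relative to existing routes: LambCircleTG's floor
NoQuietSteadyTG quantifies over EXACT steady NS sequences of the TG pattern force f♯, which HAS
exact dodgers (Λ(U_TG) = f♯), so Lamb rigidity is false there and the two routes cannot exchange
cruxes; TaylorCertificates certifies a floor by ν-indexed SOS functionals on phase space and needs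
ALL steady states bounded (its crux-line lojasiewicz-lamb-floor-ladder carried this very floor as an
approach and died 2026-08-16 at that ∀-ceiling: f_GP has a fat laminar half-branch, E =
0.75/((2π)⁴μ²), kit j015722) — here the existence clause is ∃-LIGHT, which the fat branch does not
contradict and which the light primary cyclic-symmetric branch of f_GP (E ≈ 0.86, ε ≈ 0.37 at μ ≈
1.8·10⁻³ in unit-torus units, NumericsJ006377/j014392) supports; SteadyWeakLimit is the construction
side (realise a power-absorbing subsolution), X1 is the opposite inequality. The force-agnostic
floor step of that dead line is elementary and lives inside `closes` (f_GP admissibility from the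
landed stub_gpAdmissible p85210; the residual transfer of stub_residualTransfer p85255 re-derived in
a dozen lines from the landed PhantomFloor.abs_integral_inner_laplacian_le instead of imported — see
CONE), so the deciding theorem assumes the two cruxes and nothing else.

RANKED CRUXES. #2 LambRigidGP (crux) — ν-free Lamb rigidity of f_GP at an energy level ≥ 2 (card K1;
= the open floor bet S5/C⁺ `RigidAt f_GP E c δ₀` of the dead line, inlined character-for-character
as the rigidity hypothesis of the landed stub_residualTransfer): there are E ≥ 2 and c, δ₀ > 0 such
that every smooth divergence-free mean-zero U on T³ with ∫|U|² ≤ E and every residual bound R ∈ [0,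
δ₀] (|∫⟪(U·∇)U − f_GP, w⟫| ≤ R‖∇w‖₂ for all smooth div-free mean-zero w) satisfy c ≤ R‖∇U‖₂.
Antitone in E (more competitors), so "E ≥ 2" is the weakest form composable with crux 3.
[difficulty: XL] (why it might fail: f_GP may sit in an ENLARGED magic cone (x-dependent
polarisation/curved phase with (b·∇)b+(div b)b ∥ ∇θ), or own a smooth/C^(σ>1/3) mean-zero standing
flow of energy ≤ 2 (shell-1×shell-2 pairs emit first-shell modes); rigidity sits exactly at the
stationary Nash-error borderline.) [arXiv:1401.4301, arXiv:2501.13632, arXiv:2405.08390,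
doi:10.3934/cpaa.2012.11.1661, arXiv:1710.05205,
Summits/AnomalousDissipation/AnomalousDissipation/Cruxes/SteadyStatesLoudBounded/Lines/lojasiewicz-lamb-floor-ladder.md,
Summits/AnomalousDissipation/AnomalousDissipation/Ideas/virtual-dissipation-magic-cone.md]
#3 LightSteadyStatesGP (crux) — light mean-zero steady states of the Galloway–Proctor force exist
along a vanishing-viscosity sequence (card K2): there are ν_j ∈ (0,1], ν_j → 0, and classical steady
states (u_j, p_j) of NS_(ν_j)(f_GP) on T³ (time-constant classical solutions on ℝ × T³) with ∫u_j =
0 and ∫|u_j|² ≤ 2. Monotone in the level, so the pinned 2 (≈ 2.3× the unit-torus energy 0.86 of the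
primary cyclic-symmetric branch at μ ≈ 1.8·10⁻³) is the planner's calibration; the mean-zero clause
excludes the windy/KAM drift states that killed every any-mean statement in the negatives index.
[difficulty: XL] (why it might fail: Every mean-zero steady branch of f_GP may turn heavy as ν→0:
the laminar half-branches are fat (E=0.75/((2π)⁴μ²), kit j015722) and the light primary branch
(E≈0.86 at μ≈1.8e-3, pseudo-time unstable below ν_box≈0.03) may fold or creep past 2 (local exponent
−0.2); frozen turbulence may not exist.) [Temam1979, arXiv:2402.13346,
Summits/AnomalousDissipation/AnomalousDissipation/Cruxes/SteadyStatesLoudBounded/NumericsJ006377.md,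
Summits/AnomalousDissipation/AnomalousDissipation/Cruxes/SteadyStatesLoudBounded/Lines/lojasiewicz-lamb-floor-ladder-dead.md,
FoiasManleyRosaTemam2001]
#9 KolmogorovNotRigid (support) — the provable half of the dichotomy (card P2, "magic fake"): the
Kolmogorov force sin(2πx₂)e₁ is NOT Lamb-rigid at any energy level E ≥ 1 — for all c, δ₀ > 0 the
rigidity inequality fails, witnessed by the single modulated shear wave W_λ =
a(x₂)cos(2πλx₃)(e₁+e₂)/√2 − (a′/(2√2πλ))sin(2πλx₃)e₃, a² = C − (2/π)cos 2πx₂ (exactly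
divergence-free, mean-zero; (W·∇)W = ¼(a²)′(1,1,0) + λ⁻¹(oscillation ∥ e₃) + O(λ⁻²): Ḣ⁻¹ residual
O(λ⁻²) at least, roughness O(λ), energy → C/2). Calibration deliverable, not load-bearing; kit
j004341/j004342 (residual ∝ λ^(−2.98), virtual dissipation ∝ λ^(−1.98)). [difficulty: M]
[Summits/AnomalousDissipation/AnomalousDissipation/Ideas/virtual-dissipation-magic-cone.md,
Literature.Barriers.AnomalousDissipation.Marchioro1986_globalAttraction,
doi:10.3934/cpaa.2012.11.1661]
#9 WorkLeVirtualDissipation (support) — work is dominated by virtual dissipation (card P4): for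
smooth f and smooth div-free mean-zero U, a residual bound R (against all smooth div-free mean-zero
tests) gives |∫⟪f, U⟫| ≤ R‖∇U‖₂ — test with w = U and use ∫⟪(U·∇)U, U⟫ = 0
(Torus.integral_inner_convect_eq_neg). First lower-bound handle on competitors; provable now.
[difficulty: provable-now] [DoeringFoias2002,
Literature.Analysis.FunctionSpaces.Torus.integral_inner_convect_eq_neg]

TWO-LAYER PLAN. LambRigidGP ⇐ NoOnsagerDodgerGP → LambRigidGP (k = 1 + landed glue):
`NoOnsagerDodgerGP` = every bad sequence for f_GP at level 3 (admissible, ∫|u_n|² ≤ 3, residual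
bounds R_n → 0, virtual dissipation R_n‖∇u_n‖₂ → 0) has non-divergent enstrophy — the S5 form; the
glue is LANDED and force-agnostic (stub_compactnessSplit p85561: no quiet V-point + no Onsager
dodger ⟹ RigidAt; dodgerOfQuietPoint from stub_truncationResidual p85500 + stub_dodgerAssembly
p89006: a quiet V-point of energy < E is an Onsager dodger one level up). Below that:
NoOnsagerDodgerGP ⇐ SweepingRigidity (card K3: vanishing virtual dissipation forces degeneration to
ONE oscillation family or strong convergence to a dodger; H-measure / compensated-compactness
structure theorem) → GPOffEnlargedCone (f_GP is not reachable by compatible single-wave laminates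
with x-dependent polarisation) → NoOnsagerDodgerGP. LightSteadyStatesGP ⇐ PrimaryBranchPersists (the
cyclic-symmetric primary steady branch of f_GP continues to ν → 0⁺ inside the energy ball 2:
radii-polynomial validation at checkpoints + an analytic continuation/degree argument in the
cyclic-symmetric class) → LightSteadyStatesGP, or ⇐ any frozen-turbulence construction for f_GP
(FrozenK41-type) specialised to the ball.

KILL CRITERIA. (i) A quiet point or cheap fake of f_GP inside the energy ball of LambRigidGP — a
smooth mean-zero U with ∫|U|² ≤ 2 and residual R with R‖∇U‖₂ below every c as R → 0 (in particular
an exact mean-zero steady Euler dodger of f_GP of energy ≤ 2, or the primary steady branch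
continuing LIGHT AND QUIET, ν‖∇u_ν‖² → 0 with ∫|u_ν|² ≤ 2, which is itself an Onsager-dodger
sequence) — refutes LambRigidGP: close `refuted:LambRigidGP` if the witness has energy ≤ 2 at every
level ≥ 2 (substantive); if the kill needs energy > 2 only, nothing is refuted. (ii) Every mean-zero
steady branch of f_GP heavy below some ν₀ (¬LightSteadyStatesGP, e.g. by a proof that steady states
of energy ≤ 2 do not exist for small ν) — close `refuted:LightSteadyStatesGP` or pivot the pinned
force (a generic trigonometric-polynomial force off the magic cone that passes the fat-half-branch
screen of lojasiewicz-lamb-floor-ladder-dead.md §Consequence 2) as a NEW route, not a restatement.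
(iii) SteadyNeg (stmt-AnomalousDissipation-0222: steady bounded-energy branches are quiet for every
f) proved ⇒ X2-witnesses are quiet ⇒ with X1 they cannot exist ⇒ close. (iv)
CoherentStates.SteadyZerothLaw (0219) or the summit proved elsewhere moots the route;
KolmogorovNotRigid refuted would only shrink the magic cone (no effect on the line).

NOT DECOMPOSED YET. The structure theorem behind LambRigidGP (sweeping rigidity / inverse theorem
for the Lamb map, quantitative H-measure version), the enlarged-cone membership test for f_GP, and
the exact-dodger census of f_GP beyond degree 7 — children of crux 2 once a grounder fixes the
function classes; the calibration E = 2 (planner's pin from the card probes and the primary-branch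
energy 0.86; tenure re-pins by a NEW item if a kill or a construction lands at another level, never
by rewording); the existence mechanism for crux 3 (branch continuation vs. degree theory vs.
construction); the time-dependent second rung of the card (‖∂ₜu + P div(u⊗u) −
f‖_(L²ₜḢ⁻¹)·‖∇u‖_(L²ₜₓ) = ν∫‖∇u‖², squeezing periodic/quasi-steady witnesses) — an independent
deliverable, not load-bearing; named definitions `RigidAt` / `LambResidualLE` under Theorems/
(statements are inlined verbatim instead, matching the landed stub).

CHEAPEST FALSIFIER. Continue the cyclic-symmetric primary steady branch of NS_ν(f_GP) one more
decade in ν (hub data, 2π-box units: E = ⟨|u|²⟩ 1.18 → 5.39 and D = ν⟨|∇u|²⟩ 1.27 → 0.94 for ν = 1 →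
0.028, N = 48, NumericsJ006377.md + follow-up j014392; pseudo-time unstable below ν ≈ 0.03, so
symmetry-reduced Newton–Krylov at N = 64–96 is required): LIGHT AND QUIET (E bounded, D → 0) kills
crux 2 numerically (the branch is an Onsager-dodger sequence); HEAVY (E·2π > 4π, i.e. unit-torus
energy > 2) weakens crux 3; LIGHT AND LOUD PLATEAU supports both and is a numerical summit witness.
Second cheapest: exact-gradient L-BFGS quiet-point search for f_GP at energy cap 2 and degree 8–12
(kit/dodger_search pattern of j014325): a relative Ḣ⁻¹ residual decreasing with the degree below 1 %
at bounded virtual dissipation would retire crux 2. Neither could be run from this seat this cycle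
(compute-free hub, ledger/lit services intermittent); both are recorded for the first refuter.

NUMBERS. ‖f_GP‖₂² = 3/2, ‖f_GP‖_(Ḣ⁻¹) = (3/2)^(1/2)/(2π) ≈ 0.195 (unit torus); vacuity threshold of
crux 2: fields with small residual need ∫|U|² ≥ 3/(4π) ≈ 0.239 (test w = f_GP); near-dodger data
point (Gauss–Newton, degree 2): ∫|v|² = 2.31, R = 0.030, R‖∇v‖₂ = 0.43, (f_GP, v) = 0.007 (kit
j013184) — so c ≤ 0.43 once E ≥ 2.31; L-BFGS minima at energy ≈ 0.6: R ≈ 7·10⁻³ plateau for degree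
4–6 (j014325/j015296); card probes: Kolmogorov magic fake Ḣ⁻¹ residual ∝ λ^(−2.98), virtual
dissipation ∝ λ^(−1.98) (7.1·10⁻⁵ at λ = 32), two-family plateau 0.403, non-sinusoidal-profile
plateau 0.794 (j004341/2); primary f_GP branch (unit torus): E ≈ 0.86, ε ≈ 0.375 at μ =
ν_box/(2π)^(3/2) ≈ 1.8·10⁻³; fat half-branch E = 0.75/((2π)⁴μ²) (j015722); convex-integration
calibration: stationary Nash closure 1 ≤ b ≤ (1−β)/(2β), iterates' virtual dissipation ≍
λ_q^(1−β−2βb) non-vanishing on the admissible side; Onsager saturation rate ½ = α/(1−α) at α = 1/3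
(mollified C^σ standing flows: R‖∇u‖ ≲ ℓ^(3σ−1)).

DEFINITION REQUESTS. None required: the rigidity predicate is inlined verbatim (the form of the
landed stub_residualTransfer), f_GP is the accepted inline sum of Stokes modes. Optional later: a
named `RigidAt f E c δ₀` / `LambResidualLE` under
Summits/AnomalousDissipation/AnomalousDissipation/Theorems to shorten crux 2 and its children.

CONE (route-repair 2026-08-16, unit rrepair-AnomalousDissipation-VirtualDi-b8c96913). imports =
[Literature.Analysis.FluidPDE.StokesTorus, Literature.Analysis.FluidPDE.LongTimeAveragePeriodic,
Literature.Analysis.FluidPDE.TorusClassicalLerayHopfProofs,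
Literature.Analysis.FunctionSpaces.TorusFourierCalculus,
Literature.Analysis.FunctionSpaces.TorusCalculusProofs,
Summits.….Theorems.TaylorCertificatesSteadyStatesLoudBoundedStubGpAdmissible,
Summits.….Theorems.TaylorCertificatesPhantomFloorLawPairing] on top of the gate-mandated
Summits.AnomalousDissipation.Statement. DROPPED:
Summits.….Theorems.TaylorCertificatesSteadyStatesLoudBoundedStubResidualTransfer — used only by
`closes`, and its import Literature.Analysis.FluidPDE.ClassicalOpenStripEnergy (needed there for one
four-line Green identity) → DuchonRobertInviscidLimit → DuchonRobert (→ DissipationAnomaly,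
BesovDifference, HolderNorm, …) carried the three holds-free named facts of this route's module
cone: Literature.Analysis.FluidPDE.lions_energy_equality and .cheskidov_luo_energy_equality
(@[deprecated], refuted as stated by not_lions_energy_equality(_of_pos) /
not_cheskidov_luo_energy_equality(_of_pos)) and .cheskidov_luo_anomalous (@[deprecated], unsupported
as stated) — hypotheses of no item. ADDED: …TaylorCertificatesPhantomFloorLawPairing (landed; cone
TorusEnstrophyOrthogonality + TorusFourierModes + TorusFourierCalculus, no closed facts) for
PhantomFloor.abs_integral_inner_laplacian_le. The five item decls are byte-identical to rev 0
(nothing restated); `closes` re-certified (planner Sketch.lean with exactly these imports: lean rc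
0, H21 audit ok, conclusion AnomalousDissipation, hypotheses LambRigidGP LightSteadyStatesGP, axioms
propext / Classical.choice / Quot.sound; glue 8.0 k chars). Route-attributable holds-free
module-cone facts 3 → 0 (planner census: 50 → 37 project modules in the import closure, 15 dropped
incl. ClassicalOpenStripEnergy, DuchonRobert*, DissipationAnomaly*, BesovDifference, HolderNorm; 2
added; every closed `def … : Prop` outside the Statement's own closure now has a `_holds` theorem
except LinearPMap.IsEssentiallySelfAdjoint.isSymmetric (UnboundedOperators/SymmetricPMap.lean, cite
ReedSimonI1980 §VIII.2), which enters with Literature.Analysis.FluidPDE.StokesTorus = the module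
DEFINING Torus.stokesMode, i.e. with f_GP itself, is shared verbatim by the served routes
LambCircleTG (imports = Statement + StokesTorus) and FrustratedForces, and is a hypothesis of no
item); gate decl-cone at rev 0 already 0 unproved of 49 constants, staffable. needs-fact: NONE. The
precomputed views run/shared/views/cone/AnomalousDissipation.{json,md} named in the repair payload
did not exist on this hub; the census was taken from the import headers of the cone's files. CAVEAT
FOR TENURE: a glued split of LambRigidGP that cites the landed S5 glue (stub_compactnessSplit
p85561, stub_truncationResidual p85500, stub_dodgerAssembly p89006) via `--glue-by` re-imports
Theorems files whose Literature imports (StatisticalSolution, EnergySpaceRellich,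
SteadyNavierStokesProofs, CylindricalGenerator) must pass the same module-cone screen first — check
before splitting, or re-derive the glue inline as done here.

Novelty: Searches (2026-08-16, this seat; lit FTS db and OpenAlex/S2 down or rate-limited, logged): `lit
search "stationary Euler equations convex integration steady weak solutions prescribed force"`
(crossref 8: doi:10.1137/140957354, doi:10.1016/j.jmaa.2024.129098, doi:10.3934/dcdsb.2024180 …);
`lit search --source arxiv "steady Euler convex integration"` (7: arXiv:2501.13632,
arXiv:2405.08390, arXiv:2405.08394, arXiv:2409.13103 …); `lit search --source zbmath "stationary
Euler weak solutions convex integration" --reviews` (10: arXiv:1401.4301, arXiv:1305.0773,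
arXiv:2112.03821, arXiv:2407.19671 …); `lit galaxy search "stationary incompressible Euler" |
"steady Euler flows" | "Onsager conjecture stationary" --star all` (7 / 12 / 0 rows: Isett AMS-196,
arXiv:1402.2305, no stationary forced h-principle); `lit read arXiv:2405.08390 pp.1–3` (source term
= linear Bv, L^∞ h-principle near a smooth stationary flow, Thm 1.1) and `lit read arXiv:2501.13632
pp.1–3` (Hölder steady Euler on T³, unforced, topology-preserving); hub: all 34 route files + 7
retired, 38 open + 96 closed card titles, the barrier catalogue, Cruxes/SteadyStatesLoudBounded
(Disproof notes, Lines, Numerics), `lean search` of every constant. Plus the card author's and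
critic's searches of 2026-08-15/16 (frontier since 2024, zbMATH ×3, OpenAlex ×4, arXiv ×4, galaxy)
recorded on the card.
Nearest prior art found: arXiv:1401.4301 = doi:10.1137/140957354 (Choffrut–Székelyhidi: L^∞
stationary h-principle, no prescribed body fo  [refs: 10.1137/140957354, 10.1016/j.jmaa.2024.129098, 10.3934/dcdsb.2024180, 2501.13632, 2405.08390, 2405.08394, 2409.13103, 1401.4301, 1305.0773, 2112.03821, 2407.19671, 1402.2305, 1710.05205, doi:10.1137/140957354, doi:10.1016/j.jmaa.2024.129098, doi:10.3934/dcdsb.2024180]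

Barriers (technique_class: lamb-map-approximation-rate; steady-states): - technique_class: lamb-map-approximation-rate; steady-states
- Literature.Barriers.AnomalousDissipation.BuckmasterVicol2019_thm13: evaded — convex integration is
never a witness here, only the ADVERSARY calibrating crux 2 (one-stage laminates: rate ½; stationary
Nash iterates: non-vanishing virtual dissipation on the admissible side b ≤ (1−β)/(2β)); witnesses
are exact smooth steady NS states, Leray–Hopf for free.
- Literature.Barriers.AnomalousDissipation.DrivasEyink2019_lemma1_measurable: consistent and
sharpened — crux-3 witnesses have ‖∇u_j‖₂² = ε/ν_j → ∞ (quasi-singular as required); uniformly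
B^(σ>1/3)_3 steady families are quiet, matching "mollified conservative dodgers are cheap exactly
above Onsager", which is why crux 2 also asserts that f_GP has no such standing flow in the ball.
- Literature.Barriers.AnomalousDissipation.Cheskidov2023_thm13_not_forceRobustNoAnomaly: n/a
(positive route); crux 2 is maximally NON-robust in f (magic-ness and rigidity change under
C^∞-small changes of the force), the opposite regime from the blocked class.
- Literature.Barriers.AnomalousDissipation.Marchioro1986_globalAttraction /
AlexakisDoering2006_energyDissipationBound: consistent — planar and x₃-invariant
trigonometric-polynomial forces are magic (crux 2 false there, support KolmogorovNotRigid), and f_GP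
is genuinely three-dimensional, three-component, not a steady Euler flow ((f·∇)f is not a gradient).
- Literature.Barriers.AnomalousDissipation.BrueDeLellis2023_noAnomaly_before

History (route lifecycle, newest last):
- 2026-08-26T10:53:59Z · DORMANT — reconciler: no traction for 8.3 d (last activity item-evidence-added at 2026-08-18T03:08:37Z); parked, not closed — `ledger route dormant route-AnomalousDissipa (operator:999:2554013)

sub-problem: AnomalousDissipation · status: dormant · opened planner-plan-novel-AnomalousDissipation-Anomalo-efd7bd3a-0 2026-08-16T13:54:33Z · rev 1 · ledger route-AnomalousDissipation-VirtualDissipation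
GENERATED by the gate from the ledger (D-0016/17). Provers cite these decls: `theorem foo : Summit.AnomalousDissipation.AnomalousDissipation.Theses.VirtualDissipation.<Decl> := …` in Summits/AnomalousDissipation/AnomalousDissipation/Theorems/<Name>.lean.
-/

namespace Summit.AnomalousDissipation.AnomalousDissipation.Theses.VirtualDissipation

open scoped BigOperators Topology Manifold Classical MeasureTheory ProbabilityTheory Matrix InnerProductSpace ComplexConjugate ContinuousMap
open Filter Set Function TopologicalSpace MeasureTheory

attribute [summit_statement] _root_.AnomalousDissipation

open Literature.Turb

/-- item stmt-AnomalousDissipation-15150 · crux · rank 2 · open · by planner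
why it might fail: f_GP may sit in an ENLARGED magic cone (x-dependent polarisation/curved phase with (b·∇)b+(div b)b ∥ ∇θ), or own a smooth/C^(σ>1/3) mean-zero standing flow of energy ≤ 2 (shell-1×shell-2 pairs emit first-shell modes); rigidity sits exactly at the stationary Nash-error borderline.
sources: arXiv:1401.4301, arXiv:2501.13632, arXiv:2405.08390, doi:10.3934/cpaa.2012.11.1661, arXiv:1710.05205, Summits/AnomalousDissipation/AnomalousDissipation/Cruxes/SteadyStatesLoudBounded/Lines/lojasiewicz-lamb-floor-ladder.md
[crux] ν-free Lamb rigidity of f_GP at an energy level ≥ 2 (card K1; = the open floor bet S5/C⁺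
`RigidAt f_GP E c δ₀` of the dead line, inlined character-for-character as the rigidity hypothesis
of the landed stub_residualTransfer): there are E ≥ 2 and c, δ₀ > 0 such that every smooth
divergence-free mean-zero U on T³ with ∫|U|² ≤ E and every residual bound R ∈ [0, δ₀] (|∫⟪(U·∇)U −
f_GP, w⟫| ≤ R‖∇w‖₂ for all smooth div-free mean-zero w) satisfy c ≤ R‖∇U‖₂. Antitone in E (more
competitors), so "E ≥ 2" is the weakest form composable with crux 3. [difficulty: XL] -/
@[route_item "route-AnomalousDissipation-VirtualDissipation", crux]
def LambRigidGP : Prop :=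
  ∃ E c δ₀ : ℝ, 2 ≤ E ∧ 0 < c ∧ 0 < δ₀ ∧ ∀ u : UnitAddTorus (Fin 3) → EuclideanSpace ℝ (Fin 3), Literature.Analysis.FunctionSpaces.Torus.IsSmooth u → Literature.Analysis.FunctionSpaces.Torus.IsDivFree u → Literature.Analysis.FunctionSpaces.Torus.HasZeroMean u → ∫ x, ‖u x‖ ^ 2 ≤ E → ∀ R : ℝ, 0 ≤ R → (∀ w : UnitAddTorus (Fin 3) → EuclideanSpace ℝ (Fin 3), Literature.Analysis.FunctionSpaces.Torus.IsSmooth w → Literature.Analysis.FunctionSpaces.Torus.IsDivFree w → Literature.Analysis.FunctionSpaces.Torus.HasZeroMean w → |∫ x, inner ℝ (Literature.Analysis.FunctionSpaces.Torus.convect u u x - (Literature.Analysis.FluidPDE.Torus.stokesMode (Pi.single (2 : Fin 3) (1 : ℤ)) (EuclideanSpace.single (0 : Fin 3) (1 : ℝ)) false x + Literature.Analysis.FluidPDE.Torus.stokesMode (Pi.single (0 : Fin 3) (1 : ℤ)) (EuclideanSpace.single (1 : Fin 3) (1 : ℝ)) false x + Literature.Analysis.FluidPDE.Torus.stokesMode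 (Pi.single (1 : Fin 3) (1 : ℤ)) (EuclideanSpace.single (2 : Fin 3) (1 : ℝ)) false x : EuclideanSpace ℝ (Fin 3))) (w x)| ≤ R * Real.sqrt (Literature.Analysis.FunctionSpaces.Torus.gradNormSq w)) → R ≤ δ₀ → c ≤ R * Real.sqrt (Literature.Analysis.FunctionSpaces.Torus.gradNormSq u)

/-- item stmt-AnomalousDissipation-15151 · crux · rank 3 · open · by planner
why it might fail: Every mean-zero steady branch of f_GP may turn heavy as ν→0: the laminar half-branches are fat (E=0.75/((2π)⁴μ²), kit j015722) and the light primary branch (E≈0.86 at μ≈1.8e-3, pseudo-time unstable below ν_box≈0.03) may fold or creep past 2 (local exponent −0.2); frozen turbulence may not exist.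
sources: Temam1979, arXiv:2402.13346, Summits/AnomalousDissipation/AnomalousDissipation/Cruxes/SteadyStatesLoudBounded/NumericsJ006377.md, Summits/AnomalousDissipation/AnomalousDissipation/Cruxes/SteadyStatesLoudBounded/Lines/lojasiewicz-lamb-floor-ladder-dead.md, FoiasManleyRosaTemam2001
[crux] light mean-zero steady states of the Galloway–Proctor force exist along a vanishing-viscosity
sequence (card K2): there are ν_j ∈ (0,1], ν_j → 0, and classical steady states (u_j, p_j) of
NS_(ν_j)(f_GP) on T³ (time-constant classical solutions on ℝ × T³) with ∫u_j = 0 and ∫|u_j|² ≤ 2.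
Monotone in the level, so the pinned 2 (≈ 2.3× the unit-torus energy 0.86 of the primary
cyclic-symmetric branch at μ ≈ 1.8·10⁻³) is the planner's calibration; the mean-zero clause excludes
the windy/KAM drift states that killed every any-mean statement in the negatives index. [difficulty:
XL] -/
@[route_item "route-AnomalousDissipation-VirtualDissipation", crux]
def LightSteadyStatesGP : Prop :=
  ∃ (ν : ℕ → ℝ) (u : ℕ → UnitAddTorus (Fin 3) → EuclideanSpace ℝ (Fin 3)) (p : ℕ → UnitAddTorus (Fin 3) → ℝ), (∀ j, 0 < ν j ∧ ν j ≤ 1) ∧ Filter.Tendsto ν Filter.atTop (nhds 0) ∧ (∀ j, Literature.Analysis.FunctionSpaces.Torus.IsClassicalNSSolutionOn Set.univ (ν j) (fun _ => fun x : UnitAddTorus (Fin 3) => (Literature.Analysis.FluidPDE.Torus.stokesMode (Pi.single (2 : Fin 3) (1 : ℤ)) (EuclideanSpace.single (0 : Fin 3) (1 : ℝ)) false x + Literature.Analysis.FluidPDE.Torus.stokesMode (Pi.single (0 : Fin 3) (1 : ℤ)) (EuclideanSpace.single (1 : Fin 3) (1 : ℝ)) false x + Literature.Analysis.FluidPDE.Torus.stokesMode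 (Pi.single (1 : Fin 3) (1 : ℤ)) (EuclideanSpace.single (2 : Fin 3) (1 : ℝ)) false x : EuclideanSpace ℝ (Fin 3))) (fun _ => u j) (fun _ => p j)) ∧ (∀ j, Literature.Analysis.FunctionSpaces.Torus.HasZeroMean (u j)) ∧ ∀ j, ∫ x, ‖u j x‖ ^ 2 ≤ 2

/-- item stmt-AnomalousDissipation-15152 · support · rank 9 · open · by planner
sources: Summits/AnomalousDissipation/AnomalousDissipation/Ideas/virtual-dissipation-magic-cone.md, Literature.Barriers.AnomalousDissipation.Marchioro1986_globalAttraction, doi:10.3934/cpaa.2012.11.1661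
[support] the provable half of the dichotomy (card P2, "magic fake"): the Kolmogorov force
sin(2πx₂)e₁ is NOT Lamb-rigid at any energy level E ≥ 1 — for all c, δ₀ > 0 the rigidity inequality
fails, witnessed by the single modulated shear wave W_λ = a(x₂)cos(2πλx₃)(e₁+e₂)/√2 −
(a′/(2√2πλ))sin(2πλx₃)e₃, a² = C − (2/π)cos 2πx₂ (exactly divergence-free, mean-zero; (W·∇)W =
¼(a²)′(1,1,0) + λ⁻¹(oscillation ∥ e₃) + O(λ⁻²): Ḣ⁻¹ residual O(λ⁻²) at least, roughness O(λ), energy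
→ C/2). Calibration deliverable, not load-bearing; kit j004341/j004342 (residual ∝ λ^(−2.98),
virtual dissipation ∝ λ^(−1.98)). [difficulty: M] -/
@[route_item "route-AnomalousDissipation-VirtualDissipation"]
def KolmogorovNotRigid : Prop :=
  ∀ E c δ₀ : ℝ, 1 ≤ E → 0 < c → 0 < δ₀ → ¬ (∀ u : UnitAddTorus (Fin 3) → EuclideanSpace ℝ (Fin 3), Literature.Analysis.FunctionSpaces.Torus.IsSmooth u → Literature.Analysis.FunctionSpaces.Torus.IsDivFree u → Literature.Analysis.FunctionSpaces.Torus.HasZeroMean u → ∫ x, ‖u x‖ ^ 2 ≤ E → ∀ R : ℝ, 0 ≤ R → (∀ w : UnitAddTorus (Fin 3) → EuclideanSpace ℝ (Fin 3), Literature.Analysis.FunctionSpaces.Torus.IsSmooth w → Literature.Analysis.FunctionSpaces.Torus.IsDivFree w → Literature.Analysis.FunctionSpaces.Torus.HasZeroMean w → |∫ x, inner ℝ (Literature.Analysis.FunctionSpaces.Torus.convect u u x - Literature.Analysis.FluidPDE.Torus.stokesMode (Pi.single (1 : Fin 3) (1 : ℤ)) (EuclideanSpace.single (0 : Fin 3)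 (1 : ℝ)) false x) (w x)| ≤ R * Real.sqrt (Literature.Analysis.FunctionSpaces.Torus.gradNormSq w)) → R ≤ δ₀ → c ≤ R * Real.sqrt (Literature.Analysis.FunctionSpaces.Torus.gradNormSq u))

/-- item stmt-AnomalousDissipation-15153 · support · rank 9 · open · by planner
sources: DoeringFoias2002, Literature.Analysis.FunctionSpaces.Torus.integral_inner_convect_eq_neg
[support] work is dominated by virtual dissipation (card P4): for smooth f and smooth div-free
mean-zero U, a residual bound R (against all smooth div-free mean-zero tests) gives |∫⟪f, U⟫| ≤
R‖∇U‖₂ — test with w = U and use ∫⟪(U·∇)U, U⟫ = 0 (Torus.integral_inner_convect_eq_neg). First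
lower-bound handle on competitors; provable now. [difficulty: provable-now] -/
@[route_item "route-AnomalousDissipation-VirtualDissipation"]
def WorkLeVirtualDissipation : Prop :=
  ∀ (f u : UnitAddTorus (Fin 3) → EuclideanSpace ℝ (Fin 3)) (R : ℝ), Literature.Analysis.FunctionSpaces.Torus.IsSmooth f → Literature.Analysis.FunctionSpaces.Torus.IsSmooth u → Literature.Analysis.FunctionSpaces.Torus.IsDivFree u → Literature.Analysis.FunctionSpaces.Torus.HasZeroMean u → 0 ≤ R → (∀ w : UnitAddTorus (Fin 3) → EuclideanSpace ℝ (Fin 3), Literature.Analysis.FunctionSpaces.Torus.IsSmooth w → Literature.Analysis.FunctionSpaces.Torus.IsDivFree w → Literature.Analysis.FunctionSpaces.Torus.HasZeroMean w → |∫ x, inner ℝ (Literature.Analysis.FunctionSpaces.Torus.convect u u x - f x) (w x)| ≤ R * Real.sqrt (Literature.Analysis.FunctionSpaces.Torus.gradNormSq w)) → |∫ x, inner ℝ (f x) (u x)| ≤ R * Real.sqrt (Literature.Analysis.FunctionSpaces.Torus.gradNormSq u)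

/-- item stmt-AnomalousDissipation-15154 · assembly · rank 1 · open · by planner
sources: DoeringFoias2002, RobinsonRodrigoSadowski2016, Temam1979
[assembly] LambRigidGP → LightSteadyStatesGP → AnomalousDissipation (= `closes`; the Assembly item
is closed by `fun h₁ h₂ => closes h₁ h₂`). -/
@[route_item "route-AnomalousDissipation-VirtualDissipation"]
def Assembly : Prop :=
  LambRigidGP → LightSteadyStatesGP → AnomalousDissipation

/-! D-0027 §2.1 — DECIDING THEOREM (planner-authored via `route open/edit --closes-file`; by planner-rrepair-AnomalousDissipation-VirtualDi-b8c96913-0 2026-08-16T14:13:22Z):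
its hypotheses are this route's items and its conclusion the sub-problem Statement (glue_lint), and it elaborates with this file. -/

@[closes "route-AnomalousDissipation-VirtualDissipation"] theorem closes (h₁ : LambRigidGP) (h₂ : LightSteadyStatesGP) : _root_.AnomalousDissipation := by
  obtain ⟨E, c, δ₀, hE2, hc, hδ₀, hrig⟩ := h₁
  obtain ⟨ν, u, p, hν, hν0, hsol, hmean, hlight⟩ := h₂
  -- the pinned Galloway–Proctor force
  set F : UnitAddTorus (Fin 3) → EuclideanSpace ℝ (Fin 3) := fun x => (Literature.Analysis.FluidPDE.Torus.stokesMode (Pi.single (2 : Fin 3) (1 : ℤ)) (EuclideanSpace.single (0 : Fin 3) (1 : ℝ)) false x + Literature.Analysis.FluidPDE.Torus.stokesMode (Pi.single (0 : Fin 3) (1 : ℤ)) (EuclideanSpace.single (1 : Fin 3) (1 : ℝ)) false x + Literature.Analysis.FluidPDE.Torus.stokesMode (Pi.single (1 : Fin 3) (1 : ℤ)) (EuclideanSpace.single (2 : Fin 3) (1 : ℝ)) false x : EuclideanSpace ℝ (Fin 3)) with hF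
  obtain ⟨hfs, hfd, hfz⟩ :
      Literature.Analysis.FunctionSpaces.Torus.IsSmooth F ∧ Literature.Analysis.FunctionSpaces.Torus.IsDivFree F ∧
        Literature.Analysis.FunctionSpaces.Torus.HasZeroMean F :=
    Summit.AnomalousDissipation.AnomalousDissipation.Theorems.SteadyStatesLoudBounded.GpAdmissible.stub_gpAdmissible
  -- smoothness, solenoidality and the tested steady identity of each slice
  have hus : ∀ j, Literature.Analysis.FunctionSpaces.Torus.IsSmooth (u j) := fun j =>
    (hsol j).smooth_velocity.isSmooth_slice (Set.mem_univ (0 : ℝ))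
  have hps : ∀ j, Literature.Analysis.FunctionSpaces.Torus.IsSmooth (p j) := fun j =>
    (hsol j).smooth_pressure.isSmooth_slice (Set.mem_univ (0 : ℝ))
  have hud : ∀ j, Literature.Analysis.FunctionSpaces.Torus.IsDivFree (u j) := fun j =>
    (hsol j).divFree 0 (Set.mem_univ _)
  have hst : ∀ j, ∀ w : UnitAddTorus (Fin 3) → EuclideanSpace ℝ (Fin 3),
      Literature.Analysis.FunctionSpaces.Torus.IsSmooth w → Literature.Analysis.FunctionSpaces.Torus.IsDivFree w →
      Literature.Analysis.FunctionSpaces.Torus.HasZeroMean w →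
      ∫ x, inner ℝ (ν j • Literature.Analysis.FunctionSpaces.Torus.laplacian (u j) x
        - Literature.Analysis.FunctionSpaces.Torus.convect (u j) (u j) x + F x) (w x) = 0 := by
    intro j w hw hwd hwz
    have hpt : ∀ x, ν j • Literature.Analysis.FunctionSpaces.Torus.laplacian (u j) x
        - Literature.Analysis.FunctionSpaces.Torus.convect (u j) (u j) x + F x
        = Literature.Analysis.FunctionSpaces.Torus.gradient (p j) x := by
      intro x
      have h := (hsol j).momentum 0 (Set.mem_univ _) x
      have h0 : Literature.Analysis.FunctionSpaces.Torus.timeDerivWithin Set.univ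
          (fun _ : ℝ => u j) 0 x = 0 := by
        simp [Literature.Analysis.FunctionSpaces.Torus.timeDerivWithin]
      rw [h0, zero_add] at h
      -- h : convect = ν • Δu - ∇p + F x
      have h' : Literature.Analysis.FunctionSpaces.Torus.convect (u j) (u j) x =
          ν j • Literature.Analysis.FunctionSpaces.Torus.laplacian (u j) x
            - Literature.Analysis.FunctionSpaces.Torus.gradient (p j) x + F x := h
      rw [h']
      abel
    simp_rw [hpt]
    exact Literature.Analysis.FunctionSpaces.Torus.integral_inner_gradient_eq_zero_of_isDivFree hw (hps j) hwd
  -- VIRTUAL DISSIPATION IS DISSIPATION at a steady state: the Euler residual functional of u_j is the viscous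
  -- pairing w ↦ ν_j ∫⟪w, Δu_j⟫, bounded in the dual enstrophy norm by R_j = ν_j‖∇u_j‖₂ (Green + Cauchy–Schwarz,
  -- the landed `PhantomFloor.abs_integral_inner_laplacian_le`)
  have hres : ∀ j, ∀ w : UnitAddTorus (Fin 3) → EuclideanSpace ℝ (Fin 3),
      Literature.Analysis.FunctionSpaces.Torus.IsSmooth w → Literature.Analysis.FunctionSpaces.Torus.IsDivFree w →
      Literature.Analysis.FunctionSpaces.Torus.HasZeroMean w →
      |∫ x, inner ℝ (Literature.Analysis.FunctionSpaces.Torus.convect (u j) (u j) x - F x) (w x)| ≤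
        (ν j * Real.sqrt (Literature.Analysis.FunctionSpaces.Torus.gradNormSq (u j))) *
          Real.sqrt (Literature.Analysis.FunctionSpaces.Torus.gradNormSq w) := by
    intro j w hw hwd hwz
    have hu := hus j
    have h0 := hst j w hw hwd hwz
    have iL : Integrable (fun x => inner ℝ (ν j • Literature.Analysis.FunctionSpaces.Torus.laplacian (u j) x) (w x)) volume :=
      ((hu.laplacian.smul (ν j)).inner hw).integrable
    have iC : Integrable (fun x => inner ℝ (Literature.Analysis.FunctionSpaces.Torus.convect (u j) (u j) x) (w x)) volume :=
      ((hu.convect hu).inner hw).integrable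
    have iF : Integrable (fun x => inner ℝ (F x) (w x)) volume := (hfs.inner hw).integrable
    have iLC : Integrable (fun x => inner ℝ (ν j • Literature.Analysis.FunctionSpaces.Torus.laplacian (u j) x) (w x)
        - inner ℝ (Literature.Analysis.FunctionSpaces.Torus.convect (u j) (u j) x) (w x)) volume := iL.sub iC
    simp_rw [inner_add_left, inner_sub_left] at h0
    rw [integral_add iLC iF, integral_sub iL iC] at h0
    have hlap : ∫ x, inner ℝ (ν j • Literature.Analysis.FunctionSpaces.Torus.laplacian (u j) x) (w x) =
        ν j * ∫ x, inner ℝ (w x) (Literature.Analysis.FunctionSpaces.Torus.laplacian (u j) x) := by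
      simp_rw [real_inner_smul_left]
      rw [integral_const_mul]
      exact congrArg _ (integral_congr_ae (ae_of_all _ fun x => real_inner_comm _ _))
    have heq : ∫ x, inner ℝ (Literature.Analysis.FunctionSpaces.Torus.convect (u j) (u j) x - F x) (w x) =
        ν j * ∫ x, inner ℝ (w x) (Literature.Analysis.FunctionSpaces.Torus.laplacian (u j) x) := by
      simp_rw [inner_sub_left]
      rw [integral_sub iC iF]
      linarith
    rw [heq, abs_mul, abs_of_nonneg (hν j).1.le, mul_assoc]
    refine mul_le_mul_of_nonneg_left ?_ (hν j).1.le
    rw [mul_comm]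
    exact Summit.AnomalousDissipation.AnomalousDissipation.Theorems.PhantomFloor.abs_integral_inner_laplacian_le hw hu
  -- THE FLOOR: Lamb rigidity with the residual cap ⟹ min c δ₀² ≤ ν_j‖∇u_j‖₂² (case split on R_j ≤ δ₀; uses ν_j ≤ 1)
  have hfloor : ∀ j, min c (δ₀ ^ 2) ≤ ν j * Literature.Analysis.FunctionSpaces.Torus.gradNormSq (u j) := by
    intro j
    have hG : 0 ≤ Literature.Analysis.FunctionSpaces.Torus.gradNormSq (u j) :=
      Literature.Analysis.FunctionSpaces.Torus.gradNormSq_nonneg (u j)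
    set R := ν j * Real.sqrt (Literature.Analysis.FunctionSpaces.Torus.gradNormSq (u j)) with hR
    have hR0 : 0 ≤ R := mul_nonneg (hν j).1.le (Real.sqrt_nonneg _)
    have hRG : R * Real.sqrt (Literature.Analysis.FunctionSpaces.Torus.gradNormSq (u j)) =
        ν j * Literature.Analysis.FunctionSpaces.Torus.gradNormSq (u j) := by
      rw [hR, mul_assoc, Real.mul_self_sqrt hG]
    rcases le_or_gt R δ₀ with hle | hlt
    · have h := hrig (u j) (hus j) (hud j) (hmean j) ((hlight j).trans hE2) R hR0 (hres j) hle
      rw [hRG] at h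
      exact (min_le_left _ _).trans h
    · have hR2 : R ^ 2 = ν j * (ν j * Literature.Analysis.FunctionSpaces.Torus.gradNormSq (u j)) := by
        rw [hR, mul_pow, Real.sq_sqrt hG]
        ring
      have hδR : δ₀ ^ 2 < R ^ 2 := by nlinarith [hlt, hδ₀, hR0]
      have hX : ν j * (ν j * Literature.Analysis.FunctionSpaces.Torus.gradNormSq (u j)) ≤
          ν j * Literature.Analysis.FunctionSpaces.Torus.gradNormSq (u j) :=
        mul_le_of_le_one_left (mul_nonneg (hν j).1.le hG) (hν j).2
      have h' : δ₀ ^ 2 < ν j * (ν j * Literature.Analysis.FunctionSpaces.Torus.gradNormSq (u j)) := hR2 ▸ hδR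
      exact (min_le_right _ _).trans (h'.trans_le hX).le
  refine ⟨F, hfs, hfd, hfz, ν, fun j => u j, fun j _ => u j, fun j => (hν j).1, hν0,
    fun j => (hsol j).isGlobalLerayHopf, ⟨2, fun j => ?_⟩, min c (δ₀ ^ 2), lt_min hc (pow_pos hδ₀ 2),
    fun j => ?_⟩
  · rw [Literature.Analysis.FluidPDE.meanEnergy_eq_of_periodic (τ := 1) (fun _ => rfl) one_pos]
    simpa using hlight j
  · rw [Literature.Analysis.FluidPDE.meanDissipation_eq_of_periodic (τ := 1) (fun _ => rfl) one_pos]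
    have h := hfloor j
    rw [Literature.Analysis.FunctionSpaces.Torus.gradNormSq_eq_toReal_eGradNormSq_holds (hus j)] at h
    simpa using h

end Summit.AnomalousDissipation.AnomalousDissipation.Theses.VirtualDissipation
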